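import Summits.ResolutionOfSingularities.ResolutionOfSingularities.Theorems.EquisingularLiftEquisingularLiftNatMemberSZeroAtStepRegular
import Summits.ResolutionOfSingularities.ResolutionOfSingularities.Theorems.EquisingularLiftEquisingularLiftNatMemberSLStepRegular
import HarnessLib

/-!
# [OURS · L1 W4.5(b) · EL♮(3) · T23-A‴ (U6), SHADOW-FREE ARM] THE REGULAR IN-CARRIER POINT STEP WITH PLANES: `memberS₀L_strictTransform_of_regularPoint`
# — the twin of `memberSL_strictTransform_of_regularPoint` (…NatMemberSLStepRegular p627803) on `TCPlus.MemberS₀L` (…NatSubchainSupplierInvSZeroLDefs):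
# carrier plane by rule (b) = `memberS₀At_strictTransform_of_regularPoint` (G2), new plane born with model (`TCPlus.letterDatum_newPlane`, p627803),
# away planes keep their models (`TCPlus.letters_transport_away`, p626721), planes through the point dropped; MENU = res-L1-w45b-lead-2's
# `InCarrierReachKSs` `Ps′` menu (0c6a341d172f5c17); res-L1-w45b-stub-4's request 2026-08-28T11:24:07Z

res-type-027 g18 ((U6) owner), brick (G5a). OURS; NOT a statement of any manuscript ([Hironaka2017] is a candidate under adjudication, nothing of
it is asserted); AI-written, weaker than expert review. No `sorry`; standard axioms; DEF-FREE; `--supports stmt-ResolutionOfSingularities-20148 --as helper`.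
[cite: GortzWedhorn2020, Prop. 13.91 and (13.19)] [cite: Liu2002, Thm. 8.1.19] [cite: Matsumura1987, Thm. 14.2] [cite: StacksProject, Tag 01WS]
-/

set_option linter.dupNamespace false -- mandated namespace `Summit.<Summit>.<Problem>` of this single-conjunct summit
set_option linter.overlappingInstances false -- signatures carry `[IsDomain O] [IsDiscreteValuationRing O]`

noncomputable section

open CategoryTheory CategoryTheory.Limits AlgebraicGeometry TopologicalSpace Topology IsLocalRing
open Literature.AlgebraicGeometry.Resolution
open AlgebraicGeometry.Scheme.IdealSheafData
open Summit.ResolutionOfSingularities.ResolutionOfSingularities.Theses.EquisingularLift.Split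
open Summit.ResolutionOfSingularities.ResolutionOfSingularities.Cruxes.EquisingularLift.StrataSplit

namespace Summit.ResolutionOfSingularities.ResolutionOfSingularities.Cruxes.EquisingularLiftNat.Sections

/-- **(A)S₀L — the regular in-carrier point step at `TCPlus.MemberS₀L`, menu form** (see the module docstring). [cite: Matsumura1987, Thm. 14.2 and Thm. 20.3]
[cite: GortzWedhorn2020, Prop. 13.91 and Prop. 13.96] [cite: Liu2002, Thm. 8.1.19] [cite: StacksProject, Tag 01WS] [OURS · L1 W4.5b · T23-A‴ (U6)] brick (G5a)
(stmt-ResolutionOfSingularities-20148); NOT a statement of the manuscript. -/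
theorem memberS₀L_strictTransform_of_regularPoint (O : Type) [CommRing O] [IsDomain O] [IsDiscreteValuationRing O]
    [IsAdicComplete (maximalIdeal O) O] [IsAlgClosed (ResidueField O)] (k : Type) [Field k] (θ : O →+* k)
    (hθ : Function.Surjective θ)
    (P : Scheme.{0}) (q : P ⟶ Spec (.of O)) (Y : Set P) (hY : Y ⊆ q ⁻¹' {closedPoint O}) (hYirr : IsIrreducible Y)
    (hYcl : IsClosed Y) [IsProper q] [IsIntegral P] (hPnoeth : IsLocallyNoetherian P) (hPreg : Scheme.IsRegular P)
    [SmoothOfRelativeDimension 3 q]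
    (Ch : ∀ X' : Scheme.{0}, (X' ⟶ P) → Set X' → Prop)
    (hChain : ∀ (X' : Scheme.{0}) (σ : X' ⟶ P) (S : Set X'), Ch X' σ S → Chain P Y X' σ S)
    (hStep : ∀ (X' X'' : Scheme.{0}) (σ' : X' ⟶ P) (S' : Set X') (C : X'.IdealSheafData) (τ : X'' ⟶ X'),
      Ch X' σ' S' → IsBlowup τ C → Scheme.IsRegular C.subscheme → Flat (C.subschemeι ≫ σ' ≫ q) →
      σ' '' (C.support : Set X') ⊆ {x : P | ¬ IsGenericPoint x Y} →
      (C.support : Set X') ∩ (σ' ≫ q) ⁻¹' {closedPoint O} ⊆ S' →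
      Ch X'' (τ ≫ σ') (closure (τ ⁻¹' (S' \ (C.support : Set X')))))
    -- the package transport (res-D-pv-029's T-PKG-TRANSPORT-SCHEME), used only at the excluded points
    (hpkg : ∀ ⦃X X₂ : Scheme.{0}⦄ [IsIntegral X] [IsLocallyNoetherian X] [IsLocallyNoetherian X₂] (σ : X ⟶ P)
      [IsSeparated (σ ≫ q)], Scheme.IsRegular X → ∀ (s : Spec (.of O) ⟶ X), s ≫ σ ≫ q = 𝟙 _ → ∀ (τ : X₂ ⟶ X), IsBlowup τ s.ker →
      ∀ (𝓢 K : X.IdealSheafData) (p' : X), p' ∉ (s.ker.support : Set X) → ∀ (p'₂ : X₂), τ p'₂ = p' →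
      TCPlus.CentredPackage O P q X σ 𝓢 K p' →
      TCPlus.CentredPackage O P q X₂ (τ ≫ σ) (strictTransformIdeal τ s.ker 𝓢) (strictTransformIdeal τ s.ker K) p'₂)
    -- the member and the point
    (G : Scheme.{0}) [IsIntegral G] (T Z Sd excl : Set G) (Ls : List (Set G))
    (hmem : TCPlus.MemberS₀L O k θ P q Y Ch G T Z Sd Ls excl) (hLcl : ∀ L ∈ Ls, IsClosed L)
    (hTirr : IsIrreducible T) (y : G) (hy : IsClosed ({y} : Set G)) (hyZ : y ∈ closure Z) (hyT : y ∈ T) (hTZ : ¬ T ⊆ closure Z)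
    (hyexcl : y ∉ excl)
    (hyreg : IsRegularLocalRing (G.presheaf.stalk y ⧸ stalkIdeal (vanishingIdeal ⟨closure Z, isClosed_closure⟩) y))
    (hamb : IsRegularLocalRing (G.presheaf.stalk y))
    (G₂ : Scheme.{0}) (υ₁ : G₂ ⟶ G) (hυ₁ : IsBlowup υ₁ (vanishingIdeal ⟨{y}, hy⟩)) :
    IsIntegral G₂ ∧ IsIrreducible (closure (υ₁ ⁻¹' (T \ {y}))) ∧
      ¬ closure (υ₁ ⁻¹' (T \ {y})) ⊆ closure (closure (υ₁ ⁻¹' (Z \ {y}))) ∧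
      ∀ Ls' : List (Set G₂), (∀ L' ∈ Ls', L' = υ₁ ⁻¹' {y} ∨ ∃ L ∈ Ls, y ∉ L ∧ L' = closure (υ₁ ⁻¹' (L \ {y}))) →
        (∀ L' ∈ Ls', IsClosed L') ∧
        TCPlus.MemberS₀L O k θ P q Y Ch G₂ (closure (υ₁ ⁻¹' (T \ {y}))) (closure (υ₁ ⁻¹' (Z \ {y})))
          (closure (υ₁ ⁻¹' (Sd \ {y}))) Ls' (υ₁ ⁻¹' excl) := by
  classical
  obtain ⟨X, σ, S, jG, tG, 𝓢, K, hmemAt, hLs⟩ := hmem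
  obtain ⟨s, X₂, τ, j₂, t₂, hs, hss₀, hτ, hcomm, hCb, hG₂int, hirr₂, hT₂Z₂, hmem₂⟩ :=
    memberS₀At_strictTransform_of_regularPoint O k θ hθ P q Y hY hYirr hYcl hPnoeth hPreg Ch hChain hStep hpkg G T Z Sd excl X σ S
      jG tG 𝓢 K hmemAt hTirr y hy hyZ hyT hTZ hyexcl hyreg hamb G₂ υ₁ hυ₁
  obtain ⟨hCh, hXint, hXnoeth, hXreg, -, hsq, -, hi, -, -, -, hiv, -, -, -, -, -⟩ := hmemAt
  haveI := hXint
  haveI := hXnoeth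
  -- the old stage: proper over `O`, `jG` a closed immersion, the point on `V(𝓢 ⊔ K)` hence off the generic point of `Y`
  obtain ⟨-, -, hσ⟩ := chain_isRegular P Y X σ S (hChain _ _ _ hCh) hPnoeth hPreg
  haveI := hσ
  haveI : IsProper (σ ≫ q) := inferInstance
  haveI : IsClosedImmersion (Spec.map (CommRingCat.ofHom θ)) := IsClosedImmersion.spec_of_surjective _ hθ
  haveI hjci : IsClosedImmersion jG := MorphismProperty.IsStableUnderBaseChange.of_isPullback hsq.flip inferInstance
  haveI : IsLocallyNoetherian G := LocallyOfFiniteType.isLocallyNoetherian jG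
  have hyC : jG y ∈ ((𝓢 ⊔ K).support : Set X) := by
    have h1 : y ∈ (((𝓢 ⊔ K).comap jG).support : Set G) := by
      rw [hi, Scheme.IdealSheafData.coe_support_vanishingIdeal]; exact hyZ
    rw [Scheme.IdealSheafData.support_comap] at h1
    exact h1
  have hw : ¬ IsGenericPoint (σ (jG y)) Y := hiv ⟨jG y, hyC, rfl⟩
  -- (F1) the new plane with its model; (a) the away letters; the `{jG y}`-fibre disjointness
  have hnew : TCPlus.LetterDatum O P q Y G₂ X₂ (τ ≫ σ) j₂ (υ₁ ⁻¹' {y}) :=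
    TCPlus.letterDatum_newPlane O hθ P q Y hY hXreg hsq hs hy hss₀ hw hamb hτ hυ₁ hcomm
  have hdisj : ∀ I : X.IdealSheafData, jG y ∉ (I.support : Set X) → Disjoint (I.support : Set X) (s.ker.support : Set X) :=
    fun I hI => disjoint_support_of_inter_fibre_eq_singleton (σ ≫ q) s.ker I hCb hI
  have hJ : (((vanishingIdeal ⟨{y}, hy⟩ : G.IdealSheafData)).support : Set G) = {y} :=
    Scheme.IdealSheafData.coe_support_vanishingIdeal _
  have haway := TCPlus.letters_transport_away O P q Y hτ hυ₁ hJ hcomm hdisj (fun L hL => ⟨hLcl L hL, hLs L hL⟩)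
  refine ⟨hG₂int, hirr₂, hT₂Z₂, fun Ls' hLs' => ⟨fun L' hL' => ?_, X₂, τ ≫ σ, _, j₂, t₂, _, _, hmem₂, fun L' hL' => ?_⟩⟩
  · rcases hLs' L' hL' with rfl | ⟨L, -, -, rfl⟩
    · exact hy.preimage υ₁.continuous
    · exact isClosed_closure
  · rcases hLs' L' hL' with rfl | ⟨L, hL, hyL, rfl⟩
    · exact hnew
    · exact haway L hL hyL

end Summit.ResolutionOfSingularities.ResolutionOfSingularities.Cruxes.EquisingularLiftNat.Sections

end
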